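import Summits.CriticalPhenomena.Ising3D.TaylorTableOddHeadDeltaMerged
import HarnessLib

/-!
# The TABLE layer of a derivative certificate, XXXV: the bisected sign tests assembled from their halves (SPLIT finals)
(cell `pub-ising3x`, seat boot-1 gen 10; gate (g2) — replay layout, the last per-declaration hot spot: the finals' bisection trees)

HONEST FRAMING: lottery ticket; floor = tightest certified 3D Ising CFT bounds; no exact-solution
claim without a proof. Island framing: certified exclusion region at stated derivative order and
assumptions; not a determination of the 3D Ising critical exponents beyond that.

The head-cell finals (`evenHeadPartsFinalOKΔ`, `oddHeadFinalOKΔM`) run a bisected sign test `posOn3` / `posOnDE3` / `posOnOddM` on the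
local cell `[−2^{−e}, 2^{−e}]` to depth `dP`; on a few cells the tree has 30–75 nodes and ONE `decide` over the whole tree 'does not
reduce' (the per-declaration law of HEAD-DELTA.md §8.1: the even cell ℓ = 2 [3, 3.5] of M-g5 has 61 discriminant nodes). The bisections
are literally `test (d+1) a b = core a b || (test d a m && test d m b)` with `m = (a+b)/2`, so the two HALVES, decided in separate
declarations, GIVE the parent without evaluating it: `posOn3_join`, `posOnDE3_join`, `posOnOddM_join` (one `simp`). A replay file then
decides the sub-trees at some split depth (each small) and assembles the cell's final Boolean by these lemmas and
`evenHeadPartsFinalOKΔ_of_split` / `oddHeadFinalOKΔM_of_split` (the side conditions as one cheap decide + the three / one assembled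
tests) — the landed cell theorems apply verbatim. Elementary. [folklore]
-/

namespace Summit.CriticalPhenomena.Ising3D

open Literature.Analysis.ValidatedNumerics Literature.Analysis.ValidatedNumerics.PolyMP
open Literature.Analysis.ValidatedNumerics.NumericsMP (MI)
open Literature.MathematicalPhysics.QuantumFieldTheory.ConformalBootstrap3D
open Literature.MathematicalPhysics.QuantumFieldTheory.ConformalBootstrap3D.HRTM (rowEntry pivOK)

/-- **Join for `posOn3`**: the two halves at depth `d` give the parent at depth `d + 1`. [folklore] -/
theorem posOn3_join {S : ℕ} {R0 R1 R2 : IPoly} {W : ℚ} {d : ℕ} {a b : ℚ}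
    (h1 : posOn3 S R0 R1 R2 W d a ((a + b) / 2) = true) (h2 : posOn3 S R0 R1 R2 W d ((a + b) / 2) b = true) :
    posOn3 S R0 R1 R2 W (d + 1) a b = true := by
  simp only [posOn3, h1, h2, Bool.and_self, Bool.or_true]

/-- Depth lift for `posOn3`: a test that passes at depth `d` passes at depth `d + 1` (the deeper test tries the same core first). [folklore] -/
theorem posOn3_lift {S : ℕ} {R0 R1 R2 : IPoly} {W : ℚ} : ∀ {d : ℕ} {a b : ℚ},
    posOn3 S R0 R1 R2 W d a b = true → posOn3 S R0 R1 R2 W (d + 1) a b = true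
  | 0, a, b, h => by
      simp only [posOn3] at h
      simp only [posOn3, h, Bool.true_or]
  | d + 1, a, b, h => by
      simp only [posOn3, Bool.or_eq_true, Bool.and_eq_true] at h
      rcases h with h | ⟨h1, h2⟩
      · simp only [posOn3, h, Bool.true_or]
      · exact posOn3_join (posOn3_lift h1) (posOn3_lift h2)

/-- **Join for `posOnDE3`**. [folklore] -/
theorem posOnDE3_join {S : ℕ} {TX TY TZ : ITriple} {Wx Wy Wz : ℚ} {d : ℕ} {a b : ℚ}
    (h1 : posOnDE3 S TX TY TZ Wx Wy Wz d a ((a + b) / 2) = true) (h2 : posOnDE3 S TX TY TZ Wx Wy Wz d ((a + b) / 2) b = true) :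
    posOnDE3 S TX TY TZ Wx Wy Wz (d + 1) a b = true := by
  simp only [posOnDE3, h1, h2, Bool.and_self, Bool.or_true]

/-- Depth lift for `posOnDE3`. [folklore] -/
theorem posOnDE3_lift {S : ℕ} {TX TY TZ : ITriple} {Wx Wy Wz : ℚ} : ∀ {d : ℕ} {a b : ℚ},
    posOnDE3 S TX TY TZ Wx Wy Wz d a b = true → posOnDE3 S TX TY TZ Wx Wy Wz (d + 1) a b = true
  | 0, a, b, h => by
      simp only [posOnDE3] at h
      simp only [posOnDE3, h, Bool.true_or]
  | d + 1, a, b, h => by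
      simp only [posOnDE3, Bool.or_eq_true, Bool.and_eq_true] at h
      rcases h with h | ⟨h1, h2⟩
      · simp only [posOnDE3, h, Bool.true_or]
      · exact posOnDE3_join (posOnDE3_lift h1) (posOnDE3_lift h2)

/-- **Join for `posOnOddM`** (the merged odd test). [folklore] -/
theorem posOnOddM_join {S : ℕ} {T3 T4 T5 : ITriple} {P0 : IPoly} {Tt : ITriple} {Wb Wσ Wt : ℚ} {C3 C0 Ct : MI} {d : ℕ} {a b : ℚ}
    (h1 : posOnOddM S T3 T4 T5 P0 Tt Wb Wσ Wt C3 C0 Ct d a ((a + b) / 2) = true)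
    (h2 : posOnOddM S T3 T4 T5 P0 Tt Wb Wσ Wt C3 C0 Ct d ((a + b) / 2) b = true) :
    posOnOddM S T3 T4 T5 P0 Tt Wb Wσ Wt C3 C0 Ct (d + 1) a b = true := by
  simp only [posOnOddM, h1, h2, Bool.and_self, Bool.or_true]

/-- Depth lift for `posOnOddM`. [folklore] -/
theorem posOnOddM_lift {S : ℕ} {T3 T4 T5 : ITriple} {P0 : IPoly} {Tt : ITriple} {Wb Wσ Wt : ℚ} {C3 C0 Ct : MI} : ∀ {d : ℕ} {a b : ℚ},
    posOnOddM S T3 T4 T5 P0 Tt Wb Wσ Wt C3 C0 Ct d a b = true → posOnOddM S T3 T4 T5 P0 Tt Wb Wσ Wt C3 C0 Ct (d + 1) a b = true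
  | 0, a, b, h => by
      simp only [posOnOddM] at h
      simp only [posOnOddM, h, Bool.true_or]
  | d + 1, a, b, h => by
      simp only [posOnOddM, Bool.or_eq_true, Bool.and_eq_true] at h
      rcases h with h | ⟨h1, h2⟩
      · simp only [posOnOddM, h, Bool.true_or]
      · exact posOnOddM_join (posOnOddM_lift h1) (posOnOddM_lift h2)

/-! ### The finals from their pieces -/

/-- Side conditions of the even final (everything but the three sign tests). [folklore] -/
def evenFinalSideOK (R : HeadRowsΔ) (C : EvenCellTM) (ps : List HeadPart3) : Bool :=
  decide (1 ≤ C.D) && HRTM.pivOK C.ctr C.ℓ C.e C.nF && (C.F.all fun q => decide (q.2 < R.J)) &&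
    tilesOK 0 (ps.map HeadPart3.ord0) C.F.length

/-- **The even final from its pieces**: side conditions + the three (assembled) sign tests. [folklore] -/
theorem evenHeadPartsFinalOKΔ_of_split {R : HeadRowsΔ} {dP : ℕ} {C : EvenCellTM} {ps : List HeadPart3}
    (hside : evenFinalSideOK R C ps = true)
    (hX : posOn3 R.S (sum3X ps).1 (sum3X ps).2.1 (sum3X ps).2.2 R.Wσ dP (-C.hw) C.hw = true)
    (hY : posOn3 R.S (sum3Y ps).1 (sum3Y ps).2.1 (sum3Y ps).2.2 R.Wε dP (-C.hw) C.hw = true)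
    (hD : posOnDE3 R.S (sum3X ps) (sum3Y ps) (sum3Z ps) R.Wσ R.Wε R.Wb dP (-C.hw) C.hw = true) :
    evenHeadPartsFinalOKΔ R dP C ps = true := by
  simp only [evenFinalSideOK, Bool.and_eq_true] at hside
  simp only [evenHeadPartsFinalOKΔ, Bool.and_eq_true]
  exact ⟨⟨⟨hside, hX⟩, hY⟩, hD⟩

/-- **The merged odd final from its pieces**: structural part + the (assembled) merged sign test. [folklore] -/
theorem oddHeadFinalOKΔM_of_split {R : OddHeadRowsΔ} {dP : ℕ} {C : EvenCellTM} {t₁ t₂ : ℚ} {K Mσ Mε : MI} {κ₀ : ℚ}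
    {ps : List HeadPartOdd} (hstruct : oddHeadStructOK R C t₁ t₂ κ₀ ps = true)
    (hpos : posOnOddM R.S (sumV HeadPartOdd.v3 ps) (sumV HeadPartOdd.v4 ps) (sumV HeadPartOdd.v5 ps)
      (sumPX (ps.map HeadPartOdd.v0)) (sumV HeadPartOdd.vt ps) R.Wb R.Wσ R.Wt
      (smulRatMI K ((-1) ^ C.ℓ)) (smulRatMI Mσ (κ₀⁻¹ / 2)) (smulRatMI Mε (-(κ₀⁻¹ / 2))) dP (-C.hw) C.hw = true) :
    oddHeadFinalOKΔM R dP C t₁ t₂ K Mσ Mε κ₀ ps = true := by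
  simp only [oddHeadFinalOKΔM, Bool.and_eq_true]
  exact ⟨hstruct, hpos⟩

end Summit.CriticalPhenomena.Ising3D
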